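import Literature.MathematicalPhysics.QuantumFieldTheory.Balaban1983to89.B13Sqrt27Accretive

/-!
# `Balaban1983to89.B13Sqrt27AccretiveSquare` — T. Bałaban, *Renormalization group approach to lattice gauge field
theories. II. Cluster expansions*, Commun. Math. Phys. **116** (1988) 1–22 [Balaban1988RG2Cluster], (2.7) p. 13 and
p. 15, COMPANION of `B13Sqrt27Accretive` (p422202): (§1) «G̃₃(x) = G̃₂ with the additional nonnegative, bounded and
almost local operator» — the TILTED kernel `T + x·P` localised UNIFORMLY on the compact range `x ∈ [0, γ₁]`; (§2) the
square-root decay read in a real pseudo-metric of finite range (the torus distance of the tree's letters); (§3) **the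
resolvent-integral object IS a square root at complex background: `T^{−1/2}·T^{−1/2} = T⁻¹ = C^{(k)}` for EVERY
accretive kernel** (Hermitian case by the functional calculus, general case by analytic continuation and the identity
theorem) — lifting the one caveat of `B13Sqrt27Accretive`'s honest-scope line; (§4) accretivity supplied from the
chain's standing structure (complex symmetric precision with positive definite real part)

statement-level skeleton of published theorems with citation tags; proofs where landed; nothing here is a claim about
the Yang–Mills mass gap

PDF held: `paper:balaban1988-cmp116-rg-ii-cluster` (journal page = PDF page + 0); pp. 13, 15 (materialised `p0013.txt`,
`p0015.txt`; quoted in full in `B13Sqrt27Accretive` / `B13Sqrt27` / `B13Resolvent27`).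

CITATION HEADER (verbatim, p. 13 [PDF 13]): *"More exactly, the operator C(xI + C\*Δ_kC)⁻¹C\* is representated by the
integral (3.185) [13] with the additional term −½x‖χ\*(QA + D̄μ(QA))‖² under the exponential function … This term
determines a nonnegative, bounded and almost local operator. The integral yields the representation (3.185) [13], with
the operator G̃₂ replaced by G̃₃(x), which is defined as G̃₂, but with this additional operator. The operator G̃₃(x) has
the same properties as G̃₂, especially it can be expanded into a generalized random walk expansion. This yields an
expansion of the integral above, hence an expansion of (C^{(k)})^{1/2} also."*; p. 15 [PDF 15]: *"We consider it as an
analytic function of (U, J) … the operators in it are not symmetric, and the second measure is complex. … For the pair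
(U, 0) the operators are symmetric, and the measure is positive, and then the estimates are simpler. The general case
is handled by a perturbative argument."*  ([16] (63) p. 272 [Balaban1985UV3]: the same device with `0 ≤ x ≤ 2γ₁`.)

WHAT IS REPRODUCED (cell `pub-ymgap`, D-0062 Track A, seat `dag-n10-b` g2; setting and notation of `B13Sqrt27Accretive`:
`T : Matrix n n ℂ` `m`-accretive of range one in an `ℕ`-pseudo-metric `dist`, off-diagonal sums `≤ h`,
`invSqrt T = (1/π)∫₀^∞ x^{−1/2}(x·1 + T)⁻¹dx`):
* §1 `accretive_add_smul_of_nonneg`, **`tilted_inverse_decay`**: with `P` the «additional term» (`Re⟨v, Pv⟩ ≥ 0`, range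
  one, off-diagonal row/column sums `≤ h_P`), for EVERY `x ∈ [0, γ₁]` the tilted kernel `T + x·P` is invertible and
  `‖((T + x·P)⁻¹)_{ij}‖ ≤ (2/m)·e^{−θ·dist(i,j)}` with ONE rate, `(h + γ₁h_P)(e^θ − 1) ≤ m/2` — the cell's GAPS G-B13-05 (a)
  *"x-uniform constants for G̃₃(x)"* at kernel level, on the bounded `x`-vertex `[0, γ₁]` that `B13Sqrt27` §4 shows is
  all (2.7) needs (the tree's `Literature.Analysis.Matrix.accretive_combes_thomas`).
* §2 **`norm_invSqrt_apply_le_real`**: for a real pseudo-metric `d ≥ 0` and `d`-range `≤ r`,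
  `‖(T^{−1/2})_{ij}‖ ≤ (2/√m)·e^{−(θ/r)·d(i,j)}` (coarse metric `⌈d/r⌉₊`; the form in which the torus distance `d₁` of
  `NodeOLetters.KernelLetters` enters).
* §4 **`accretive_of_isSymm_re_coercive`** — the hypothesis `hacc` of both files SUPPLIED from the §2-chain's standing
  structure (`B13Lemma3TorusPrimitive.h226_torus_of_primitives`: `hAs` complex SYMMETRIC precision, `hA` positive
  definite REAL PART): a `γ`-coercive real part makes a complex symmetric kernel `γ`-accretive (the symmetric
  imaginary part drops out of `Re⟨v, Av⟩`).
* §3a `differentiableOn_invSqrt_apply_of_isOpen` — `B13Sqrt27Accretive` §6 on an arbitrary open set of the configuration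
  space.  §3b (the symmetric point over `ℂ`): `invSqrt_eq_cfc_of_posDef` (`invSqrt A = cfc (t ↦ t^{−1/2}) A` for a
  positive definite Hermitian `A`, eigenvalue by eigenvalue via `Literature.LinearAlgebra.Matrix.cfc_apply_eq_sum` and
  `B13Sqrt27.integral_kernel_Ioi`), `invSqrt_mul_invSqrt_of_posDef`.  §3c **`invSqrt_mul_invSqrt`: `invSqrt T · invSqrt T
  = T⁻¹` for every `m`-accretive `T`, `m > 0`** — write `T = H + iK` with `H = (T + Tᴴ)/2`, `K = (T − Tᴴ)/(2i)`
  Hermitian; the family `z ↦ H + zK = T + (z − i)K` is `m/2`-accretive on the open convex strip `|Re z|·κ < m/2`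
  (`κ` the total mass of `K`), so the entries of `(H + zK)^{−1/2}·(H + zK)^{−1/2} − (H + zK)⁻¹` are holomorphic there
  (§3a + Cramer) and vanish for real `z` (positive definite Hermitian, §3b); by the identity theorem (Mathlib's
  `AnalyticOnNhd.eqOn_zero_of_preconnected_of_frequently_eq_zero`, `DifferentiableOn.analyticOnNhd`) they vanish on
  the strip, in particular at `z = i`.
HONEST SCOPE.  Finite-matrix theorems; nothing of Bałaban's `Δ_k`, `C^{(k)}`, `G̃₂`, `G̃₃` constructed; the
σ-polydisc direction of (2.16) (walks through the σ₀-cubes, NODE O ∕ G-B9-10) untouched, as in `B13Sqrt27Accretive`.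
No definition, no instance, no notation, no `sorry`, no named fact.  NOT continuum, NOT Clay.
-/

noncomputable section

open MeasureTheory Set Filter Topology Finset Metric
open scoped Matrix ComplexConjugate Real

namespace Literature.MathematicalPhysics.QuantumFieldTheory.Balaban1983to89.B13Sqrt27AccretiveSquare

open Literature.Analysis.Matrix (accretive_combes_thomas)
open Literature.MathematicalPhysics.QuantumFieldTheory.Balaban1983to89.B13Sqrt27
  (kernel kernel_nonneg integral_kernel_Ioi integrableOn_kernel_Ioi)
open Literature.MathematicalPhysics.QuantumFieldTheory.Balaban1983to89.B13Sqrt27Accretive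

variable {n : Type*} [Fintype n] [DecidableEq n]

omit [DecidableEq n] in
/-- Schur bound for a form: absolute row and column sums of `P` `≤ p` give `|Re Σ conj(v_i)(Pv)_i| ≤ p·Σ|v_i|²`
(private copy of `B13Sqrt27Accretive`'s helper). [folklore] -/
private theorem abs_re_form_le (P : Matrix n n ℂ) {p : ℝ} (hp : 0 ≤ p)
    (hrow : ∀ i, ∑ j, ‖P i j‖ ≤ p) (hcol : ∀ j, ∑ i, ‖P i j‖ ≤ p) (v : n → ℂ) :
    |(∑ i, star (v i) * (P *ᵥ v) i).re| ≤ p * ∑ i, ‖v i‖ ^ 2 := by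
  set S : ℝ := ∑ i, ‖v i‖ ^ 2 with hS
  have hS0 : 0 ≤ S := Finset.sum_nonneg fun i _ => by positivity
  have h1 : |(∑ i, star (v i) * (P *ᵥ v) i).re| ≤ ‖star v ⬝ᵥ (P *ᵥ v)‖ :=
    (Complex.abs_re_le_norm _).trans_eq rfl
  have h2 := Literature.Analysis.Matrix.norm_star_dotProduct_le_sqrt_mul_sqrt v (P *ᵥ v)
  have h3 := Literature.Analysis.Matrix.sum_norm_sq_mulVec_le_of_rowSum_le_of_colSum_le P hp hrow hcol v
  have h4 : Real.sqrt (∑ i, ‖(P *ᵥ v) i‖ ^ 2) ≤ p * Real.sqrt S := by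
    rw [← Real.sqrt_sq hp, ← Real.sqrt_mul (sq_nonneg p)]
    exact Real.sqrt_le_sqrt (by nlinarith [h3])
  calc |(∑ i, star (v i) * (P *ᵥ v) i).re| ≤ Real.sqrt S * Real.sqrt (∑ i, ‖(P *ᵥ v) i‖ ^ 2) := h1.trans h2
    _ ≤ Real.sqrt S * (p * Real.sqrt S) := mul_le_mul_of_nonneg_left h4 (Real.sqrt_nonneg _)
    _ = p * S := by rw [mul_left_comm, Real.mul_self_sqrt hS0]

/-! ## §1. The TILTED resolvent «G̃₃(x) = G̃₂ with the additional nonnegative, bounded and almost local operator»: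
Combes–Thomas UNIFORMLY on the compact range `x ∈ [0, γ₁]` of (2.7) -/

omit [DecidableEq n] in
/-- **Accretivity survives a nonnegative tilt**: if `T` is `m`-accretive and the form of `P` has nonnegative real
part (print: *"This term determines a nonnegative … operator"*), then `T + x·P` is `m`-accretive for every real
`x ≥ 0`. [cite: Balaban1988RG2Cluster, (2.7) p.13] -/
theorem accretive_add_smul_of_nonneg {T P : Matrix n n ℂ} {m : ℝ}
    (hacc : ∀ v : n → ℂ, m * ∑ i, ‖v i‖ ^ 2 ≤ (∑ i, star (v i) * (T *ᵥ v) i).re)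
    (hP : ∀ v : n → ℂ, 0 ≤ (∑ i, star (v i) * (P *ᵥ v) i).re) {x : ℝ} (hx : 0 ≤ x) (v : n → ℂ) :
    m * ∑ i, ‖v i‖ ^ 2 ≤ (∑ i, star (v i) * ((T + (x : ℂ) • P) *ᵥ v) i).re := by
  have hsplit : (∑ i, star (v i) * ((T + (x : ℂ) • P) *ᵥ v) i)
      = (∑ i, star (v i) * (T *ᵥ v) i) + (x : ℂ) * ∑ i, star (v i) * (P *ᵥ v) i := by
    simp only [Matrix.add_mulVec, Matrix.smul_mulVec, Pi.add_apply, Pi.smul_apply, smul_eq_mul, mul_add,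
      Finset.sum_add_distrib, Finset.mul_sum]
    congr 1
    exact Finset.sum_congr rfl fun i _ => by ring
  rw [hsplit, Complex.add_re, Complex.re_ofReal_mul]
  nlinarith [hacc v, hP v, mul_nonneg hx (hP v)]

/-- **«THE OPERATOR G̃₃(x) HAS THE SAME PROPERTIES AS G̃₂» — x-UNIFORM LOCALISATION OF THE TILTED INVERSE ON THE
COMPACT RANGE OF (2.7).**  Let `T` be `m`-accretive of range one with off-diagonal row/column sums `≤ h` (the kernel
behind G̃₂) and `P` the *"additional term"*: nonnegative form (`Re⟨v, Pv⟩ ≥ 0`), *"bounded and almost local"* (range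
one in `dist`, off-diagonal row/column sums `≤ h_P`).  Then for EVERY `x ∈ [0, γ₁]` the tilted kernel `T + x·P` is
invertible and `‖((T + x·P)⁻¹)_{ij}‖ ≤ (2/m)·e^{−θ·dist(i,j)}` with ONE rate `θ` for the whole range, determined by
`(h + γ₁·h_P)(e^θ − 1) ≤ m/2` — the cell's G-B13-05 (a) *"x-uniform constants"* at kernel level, on the bounded
`x`-vertex `[0, γ₁]` that `B13Sqrt27` §4 shows is all (2.7) needs ([16] (63): `0 ≤ x ≤ 2γ₁`).
[cite: Balaban1988RG2Cluster, (2.7) p.13, p.15] -/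
theorem tilted_inverse_decay (dist : n → n → ℕ) (hd0 : ∀ i, dist i i = 0)
    (hds : ∀ i j, dist i j = dist j i) (hdt : ∀ i j k, dist i k ≤ dist i j + dist j k)
    (T P : Matrix n n ℂ) (hrange : ∀ i j, T i j ≠ 0 → dist i j ≤ 1) (hrangeP : ∀ i j, P i j ≠ 0 → dist i j ≤ 1)
    (h hP γ₁ : ℝ)
    (hrow : ∀ i, ∑ j ∈ univ.filter (fun j => dist i j ≠ 0), ‖T i j‖ ≤ h)
    (hcol : ∀ j, ∑ i ∈ univ.filter (fun i => dist i j ≠ 0), ‖T i j‖ ≤ h)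
    (hrowP : ∀ i, ∑ j ∈ univ.filter (fun j => dist i j ≠ 0), ‖P i j‖ ≤ hP)
    (hcolP : ∀ j, ∑ i ∈ univ.filter (fun i => dist i j ≠ 0), ‖P i j‖ ≤ hP)
    (m θ : ℝ) (hm : 0 < m) (hθ : 0 ≤ θ)
    (hacc : ∀ v : n → ℂ, m * ∑ i, ‖v i‖ ^ 2 ≤ (∑ i, star (v i) * (T *ᵥ v) i).re)
    (hPnn : ∀ v : n → ℂ, 0 ≤ (∑ i, star (v i) * (P *ᵥ v) i).re)
    (hη : (h + γ₁ * hP) * (Real.exp θ - 1) ≤ m / 2) {x : ℝ} (hx : 0 ≤ x) (hxγ : x ≤ γ₁) :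
    IsUnit (T + (x : ℂ) • P).det ∧
      ∀ i j, ‖(T + (x : ℂ) • P)⁻¹ i j‖ ≤ 2 / m * Real.exp (-(θ * dist i j)) := by
  set A : Matrix n n ℂ := T + (x : ℂ) • P with hA
  have hAij : ∀ i j, A i j = T i j + (x : ℂ) * P i j := fun i j => by simp [hA]
  have hrangeA : ∀ i j, A i j ≠ 0 → dist i j ≤ 1 := by
    intro i j hij
    rw [hAij] at hij
    by_cases hT : T i j = 0
    · have hPij : P i j ≠ 0 := fun h0 => hij (by rw [hT, h0, mul_zero, add_zero])
      exact hrangeP i j hPij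
    · exact hrange i j hT
  have hnormA : ∀ i j, ‖A i j‖ ≤ ‖T i j‖ + x * ‖P i j‖ := fun i j => by
    rw [hAij]
    refine (norm_add_le _ _).trans ?_
    rw [norm_mul, Complex.norm_real, Real.norm_eq_abs, abs_of_nonneg hx]
  have he : 0 ≤ Real.exp θ - 1 := sub_nonneg.2 (Real.one_le_exp hθ)
  have hrowA : ∀ i, ∑ j ∈ univ.filter (fun j => dist i j ≠ 0), ‖A i j‖ ≤ h + γ₁ * hP := fun i => by
    calc ∑ j ∈ univ.filter (fun j => dist i j ≠ 0), ‖A i j‖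
        ≤ ∑ j ∈ univ.filter (fun j => dist i j ≠ 0), (‖T i j‖ + x * ‖P i j‖) :=
          Finset.sum_le_sum fun j _ => hnormA i j
      _ = (∑ j ∈ univ.filter (fun j => dist i j ≠ 0), ‖T i j‖)
            + x * ∑ j ∈ univ.filter (fun j => dist i j ≠ 0), ‖P i j‖ := by
          rw [Finset.sum_add_distrib, Finset.mul_sum]
      _ ≤ h + γ₁ * hP := add_le_add (hrow i) (mul_le_mul hxγ (hrowP i)
            (Finset.sum_nonneg fun j _ => norm_nonneg _) (hx.trans hxγ))
  have hcolA : ∀ j, ∑ i ∈ univ.filter (fun i => dist i j ≠ 0), ‖A i j‖ ≤ h + γ₁ * hP := fun j => by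
    calc ∑ i ∈ univ.filter (fun i => dist i j ≠ 0), ‖A i j‖
        ≤ ∑ i ∈ univ.filter (fun i => dist i j ≠ 0), (‖T i j‖ + x * ‖P i j‖) :=
          Finset.sum_le_sum fun i _ => hnormA i j
      _ = (∑ i ∈ univ.filter (fun i => dist i j ≠ 0), ‖T i j‖)
            + x * ∑ i ∈ univ.filter (fun i => dist i j ≠ 0), ‖P i j‖ := by
          rw [Finset.sum_add_distrib, Finset.mul_sum]
      _ ≤ h + γ₁ * hP := add_le_add (hcol j) (mul_le_mul hxγ (hcolP j)
            (Finset.sum_nonneg fun i _ => norm_nonneg _) (hx.trans hxγ))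
  exact accretive_combes_thomas dist hd0 hds hdt A hrangeA (h + γ₁ * hP) hrowA hcolA m θ hm hθ
    (accretive_add_smul_of_nonneg hacc hPnn hx) hη

/-! ## §2. Reading the bounds in a real-valued pseudo-metric of finite range (e.g. the torus distance `d₁`) -/

/-- **Coarse-graining a real pseudo-metric**: for a real pseudo-metric `d ≥ 0` and a range `r > 0`, `⌈d/r⌉₊` is an
`ℕ`-valued pseudo-metric in which a kernel of `d`-range `≤ r` has range one, and `e^{−θ⌈d/r⌉₊} ≤ e^{−(θ/r)·d}` —
so every bound of `B13Sqrt27Accretive` reads in the torus distance at rate `θ/r`. [folklore] -/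
private theorem natCeil_div_pseudo {ι : Type*} (d : ι → ι → ℝ) (hd0 : ∀ i, d i i = 0)
    (hds : ∀ i j, d i j = d j i) (hdt : ∀ i j k, d i k ≤ d i j + d j k) {r : ℝ} (hr : 0 < r) :
    (∀ i, ⌈d i i / r⌉₊ = 0) ∧ (∀ i j, ⌈d i j / r⌉₊ = ⌈d j i / r⌉₊) ∧
      (∀ i j k, ⌈d i k / r⌉₊ ≤ ⌈d i j / r⌉₊ + ⌈d j k / r⌉₊) := by
  refine ⟨fun i => by rw [hd0, zero_div, Nat.ceil_zero], fun i j => by rw [hds], fun i j k => ?_⟩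
  calc ⌈d i k / r⌉₊ ≤ ⌈d i j / r + d j k / r⌉₊ :=
        Nat.ceil_le_ceil (by rw [← add_div]; exact div_le_div_of_nonneg_right (hdt i j k) hr.le)
    _ ≤ ⌈d i j / r⌉₊ + ⌈d j k / r⌉₊ := Nat.ceil_add_le _ _

/-- The exponential weight in the coarse metric dominates the weight in the real metric at rate `θ/r`:
`e^{−θ·⌈d/r⌉₊} ≤ e^{−(θ/r)·d}` (`θ ≥ 0`, `r > 0`, `d ≥ 0`). [folklore] -/
private theorem exp_natCeil_le {dij θ r : ℝ} (hθ : 0 ≤ θ) :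
    Real.exp (-(θ * (⌈dij / r⌉₊ : ℕ))) ≤ Real.exp (-(θ / r * dij)) := by
  apply Real.exp_le_exp.2
  have h1 : dij / r ≤ (⌈dij / r⌉₊ : ℝ) := Nat.le_ceil _
  have h2 : θ / r * dij = θ * (dij / r) := by ring
  rw [h2]
  nlinarith

/-- **The square-root decay in a real pseudo-metric** (the torus form consumers use): if `T` is `m`-accretive,
has `d`-range `≤ r` (`T i j ≠ 0 → d i j ≤ r`) for a real pseudo-metric `d ≥ 0`, off-diagonal (`d ≠ 0`) absolute
row/column sums `≤ h`, and `h(e^θ − 1) ≤ m/2`, then `‖(T^{−1/2})_{ij}‖ ≤ (2/√m)·e^{−(θ/r)·d(i,j)}`.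
[cite: Balaban1988RG2Cluster, (2.7) p.13, (2.16) p.16] -/
theorem norm_invSqrt_apply_le_real (d : n → n → ℝ) (hd0 : ∀ i, d i i = 0)
    (hds : ∀ i j, d i j = d j i) (hdt : ∀ i j k, d i k ≤ d i j + d j k) (hdnn : ∀ i j, 0 ≤ d i j)
    {r : ℝ} (hr : 0 < r) (T : Matrix n n ℂ) (hrange : ∀ i j, T i j ≠ 0 → d i j ≤ r) (h : ℝ)
    (hrow : ∀ i, ∑ j ∈ univ.filter (fun j => d i j ≠ 0), ‖T i j‖ ≤ h)
    (hcol : ∀ j, ∑ i ∈ univ.filter (fun i => d i j ≠ 0), ‖T i j‖ ≤ h)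
    (m θ : ℝ) (hm : 0 < m) (hθ : 0 ≤ θ)
    (hacc : ∀ v : n → ℂ, m * ∑ i, ‖v i‖ ^ 2 ≤ (∑ i, star (v i) * (T *ᵥ v) i).re)
    (hη : h * (Real.exp θ - 1) ≤ m / 2) (i j : n) :
    ‖invSqrt T i j‖ ≤ 2 / Real.sqrt m * Real.exp (-(θ / r * d i j)) := by
  obtain ⟨hc0, hcs, hct⟩ := natCeil_div_pseudo d hd0 hds hdt hr
  -- the coarse metric has the same off-diagonal support as `d`
  have hsame : ∀ i j, (⌈d i j / r⌉₊ ≠ 0) ↔ (d i j ≠ 0) := fun i j => by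
    rw [not_iff_not, Nat.ceil_eq_zero, div_nonpos_iff]
    constructor
    · rintro (⟨_, h2⟩ | ⟨h1, _⟩)
      · exact absurd h2 (not_le.2 hr)
      · exact le_antisymm h1 (hdnn i j)
    · intro h0; right; exact ⟨h0.le, hr.le⟩
  have hrange' : ∀ i j, T i j ≠ 0 → ⌈d i j / r⌉₊ ≤ 1 := fun i j hij => by
    refine Nat.ceil_le.2 ?_
    rw [Nat.cast_one, div_le_one hr]
    exact hrange i j hij
  have hrow' : ∀ i, ∑ j ∈ univ.filter (fun j => ⌈d i j / r⌉₊ ≠ 0), ‖T i j‖ ≤ h := fun i => by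
    rw [Finset.filter_congr (fun j _ => hsame i j)]; exact hrow i
  have hcol' : ∀ j, ∑ i ∈ univ.filter (fun i => ⌈d i j / r⌉₊ ≠ 0), ‖T i j‖ ≤ h := fun j => by
    rw [Finset.filter_congr (fun i _ => hsame i j)]; exact hcol j
  have hb := norm_invSqrt_apply_le (fun i j => ⌈d i j / r⌉₊) hc0 hcs hct T hrange' h hrow' hcol' m θ hm hθ hacc hη
    i j
  exact hb.trans (mul_le_mul_of_nonneg_left (exp_natCeil_le hθ) (by positivity))


/-! ## §3. THE OBJECT IS A SQUARE ROOT AT COMPLEX BACKGROUND: `T^{−1/2}·T^{−1/2} = T⁻¹ = C^{(k)}` for every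
accretive kernel — the Hermitian case by the functional calculus, the general case by analytic continuation along
`z ↦ H + zK` (`T = H + iK`) and the identity theorem -/

section Square

open scoped ComplexOrder

/-! ### §3a. Holomorphy on a general open set of the configuration space (the argument of `B13Sqrt27Accretive` §6 verbatim) -/

section OpenSet

variable {E : Type*} [NormedAddCommGroup E] [NormedSpace ℂ E]

/-- `B13Sqrt27Accretive.differentiableOn_invSqrt_apply` (§6 there) on an arbitrary OPEN set `U` of the configuration space: the square root of an entrywise-holomorphic,
uniformly `m`-accretive family on `U` is entrywise holomorphic on `U`. [cite: Balaban1988RG2Cluster, (2.7) p.13, p.15] -/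
theorem differentiableOn_invSqrt_apply_of_isOpen (T : E → Matrix n n ℂ) {U : Set E} (hU : IsOpen U) {m : ℝ}
    (hm : 0 < m)
    (hacc : ∀ u ∈ U, ∀ v : n → ℂ, m * ∑ i, ‖v i‖ ^ 2 ≤ (∑ i, star (v i) * (T u *ᵥ v) i).re)
    (hT : ∀ i j, DifferentiableOn ℂ (fun u => T u i j) U) (i j : n) :
    DifferentiableOn ℂ (fun u => invSqrt (T u) i j) U := by
  have heq : (fun u => invSqrt (T u) i j) = fun u => (π⁻¹ : ℝ) • ∫ x in Ioi (0 : ℝ),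
      (Real.sqrt x)⁻¹ • ((x : ℂ) • (1 : Matrix n n ℂ) + T u)⁻¹ i j := by
    funext u; rw [invSqrt_apply]
  rw [heq]
  have hint : DifferentiableOn ℂ (fun u => ∫ x in Ioi (0 : ℝ),
      (Real.sqrt x)⁻¹ • ((x : ℂ) • (1 : Matrix n n ℂ) + T u)⁻¹ i j) U := by
    refine Literature.Analysis.Complex.differentiableOn_integral_of_dominated
      (F := fun u (x : ℝ) => (Real.sqrt x)⁻¹ • ((x : ℂ) • (1 : Matrix n n ℂ) + T u)⁻¹ i j)
      (fun u hu => aestronglyMeasurable_integrand (T u) hm (hacc u hu) i j) ?_ ?_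
    · refine ae_restrict_of_forall_mem measurableSet_Ioi fun x hx => ?_
      have hx0 : (0 : ℝ) < x := hx
      have hres : DifferentiableOn ℂ (fun u => ((x : ℂ) • (1 : Matrix n n ℂ) + T u)⁻¹ i j) U := by
        refine differentiableOn_inv_apply (A := fun u => (x : ℂ) • (1 : Matrix n n ℂ) + T u) (fun k l => ?_)
          (fun u hu => (resolvent_bound_of_accretive (T u) hm (hacc u hu) hx0.le).1) i j
        simp only [Matrix.add_apply]
        exact (differentiableOn_const _).add (hT k l)
      exact hres.const_smul ((Real.sqrt x)⁻¹)
    · intro u₀ hu₀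
      obtain ⟨ε, hε, hsub⟩ := Metric.isOpen_iff.1 hU u₀ hu₀
      refine ⟨ε, hε, hsub, fun x => 2 * 1 * kernel m x, (integrableOn_kernel_Ioi hm).const_mul (2 * 1), ?_⟩
      refine ae_restrict_of_forall_mem measurableSet_Ioi fun x hx p hp => ?_
      exact norm_integrand_le (fun y hy =>
        ((resolvent_bound_of_accretive (T p) hm (hacc p (hsub hp)) hy).2 i j).trans_eq (mul_one _).symm) hx
  exact hint.const_smul (π⁻¹ : ℝ)

end OpenSet

/-! ### §3b. The positive definite Hermitian case (the symmetric point over `ℂ`): `invSqrt = cfc (t ↦ t^{−1/2})` -/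

/-- The real spectrum of a positive definite complex Hermitian matrix is positive. [folklore] -/
private theorem spectrum_pos_of_posDef {A : Matrix n n ℂ} (hA : A.PosDef) : ∀ t ∈ spectrum ℝ A, 0 < t := by
  intro t ht
  rw [hA.1.spectrum_real_eq_range_eigenvalues] at ht
  obtain ⟨k, rfl⟩ := ht
  exact hA.eigenvalues_pos k

/-- `(x : ℂ)·1 = algebraMap ℝ (Matrix n n ℂ) x`. [folklore] -/
private theorem coe_smul_one_eq_algebraMap (x : ℝ) :
    (x : ℂ) • (1 : Matrix n n ℂ) = algebraMap ℝ (Matrix n n ℂ) x := by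
  rw [Algebra.algebraMap_eq_smul_one]
  ext i j
  simp [Matrix.smul_apply, Matrix.one_apply]

/-- The resolvent of a positive definite Hermitian matrix as a functional calculus: `(x·1 + A)⁻¹ =
cfc (t ↦ (x + t)⁻¹) A`, `x ≥ 0`. [folklore] -/
private theorem resolvent_eq_cfc_of_posDef {A : Matrix n n ℂ} (hA : A.PosDef) {x : ℝ} (hx : 0 ≤ x) :
    ((x : ℂ) • (1 : Matrix n n ℂ) + A)⁻¹ = cfc (fun t : ℝ => (x + t)⁻¹) A := by
  have hA' : IsSelfAdjoint A := hA.1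
  have hne : ∀ t ∈ spectrum ℝ A, x + t ≠ 0 := fun t ht =>
    (add_pos_of_nonneg_of_pos hx (spectrum_pos_of_posDef hA t ht)).ne'
  rw [cfc_inv (fun t : ℝ => x + t) A hne, cfc_const_add x (fun t : ℝ => t) A, cfc_id' ℝ A,
    coe_smul_one_eq_algebraMap, Matrix.nonsing_inv_eq_ringInverse]

/-- **At a positive definite HERMITIAN `A` the resolvent-integral object is the functional-calculus `A^{−1/2}`**
(the (2.7) identity over `ℂ`, eigenvalue by eigenvalue). [cite: Balaban1988RG2Cluster, (2.7) p.13, p.15] -/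
theorem invSqrt_eq_cfc_of_posDef {A : Matrix n n ℂ} (hA : A.PosDef) :
    invSqrt A = cfc (fun t : ℝ => (Real.sqrt t)⁻¹) A := by
  have hev : ∀ k, 0 < hA.1.eigenvalues k := hA.eigenvalues_pos
  -- a unitary diagonalisation with a plain matrix variable `V`
  obtain ⟨V, hV, hAV⟩ : ∃ V : Matrix n n ℂ, V ∈ Matrix.unitaryGroup n ℂ ∧
      A = V * Matrix.diagonal (fun k => ((hA.1.eigenvalues k : ℝ) : ℂ)) * star V :=
    ⟨_, hA.1.eigenvectorUnitary.2, hA.1.spectral_theorem⟩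
  have hpt : ∀ (a b : ℂ) (lam x : ℝ),
      (Real.sqrt x)⁻¹ • (a * (((x + lam)⁻¹ : ℝ) : ℂ) * b) = (a * b) * ((kernel lam x : ℝ) : ℂ) := by
    intro a b lam x
    rw [kernel, Complex.real_smul]
    push_cast
    ring
  ext i j
  have hint_eq : ∀ x ∈ Ioi (0 : ℝ), (Real.sqrt x)⁻¹ • ((x : ℂ) • (1 : Matrix n n ℂ) + A)⁻¹ i j
      = ∑ k, (V i k * star (V j k)) * ((kernel (hA.1.eigenvalues k) x : ℝ) : ℂ) := by
    intro x hx
    have hx0 : (0 : ℝ) < x := hx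
    rw [resolvent_eq_cfc_of_posDef hA hx0.le,
      Literature.LinearAlgebra.Matrix.cfc_apply_eq_sum hV hAV _ i j, Finset.smul_sum]
    exact Finset.sum_congr rfl fun k _ => hpt _ _ _ _
  rw [invSqrt_apply, setIntegral_congr_fun measurableSet_Ioi hint_eq,
    integral_finsetSum _ (fun k _ => ((integrableOn_kernel_Ioi (hev k)).ofReal.const_mul _)),
    Literature.LinearAlgebra.Matrix.cfc_apply_eq_sum hV hAV _ i j, Finset.smul_sum]
  refine Finset.sum_congr rfl fun k _ => ?_
  have h2 : (∫ x in Ioi (0 : ℝ), ((kernel (hA.1.eigenvalues k) x : ℝ) : ℂ))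
      = ((∫ x in Ioi (0 : ℝ), kernel (hA.1.eigenvalues k) x : ℝ) : ℂ) := integral_ofReal
  rw [integral_const_mul, h2, integral_kernel_Ioi (hev k)]
  have hπ : (π : ℂ) ≠ 0 := Complex.ofReal_ne_zero.2 Real.pi_ne_zero
  have hsq : ((Real.sqrt (hA.1.eigenvalues k) : ℝ) : ℂ) ≠ 0 :=
    Complex.ofReal_ne_zero.2 (Real.sqrt_pos.2 (hev k)).ne'
  have key : (π⁻¹ : ℝ) • (V i k * star (V j k) * ((π / Real.sqrt (hA.1.eigenvalues k) : ℝ) : ℂ))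
      = V i k * (((Real.sqrt (hA.1.eigenvalues k))⁻¹ : ℝ) : ℂ) * star (V j k) := by
    rw [Complex.real_smul]
    push_cast
    field_simp
  exact key

/-- **… and there `T^{−1/2}·T^{−1/2} = T⁻¹`** (functional calculus, `(√t)⁻¹·(√t)⁻¹ = t⁻¹` on the positive spectrum).
[cite: Balaban1988RG2Cluster, (2.7) p.13, p.15] -/
theorem invSqrt_mul_invSqrt_of_posDef {A : Matrix n n ℂ} (hA : A.PosDef) : invSqrt A * invSqrt A = A⁻¹ := by
  rw [invSqrt_eq_cfc_of_posDef hA]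
  have hA' : IsSelfAdjoint A := hA.1
  have hcont : ContinuousOn (fun t : ℝ => (Real.sqrt t)⁻¹) (spectrum ℝ A) :=
    Real.continuous_sqrt.continuousOn.inv₀ fun t ht => (Real.sqrt_pos.2 (spectrum_pos_of_posDef hA t ht)).ne'
  rw [← cfc_mul _ _ A hcont hcont]
  have h1 : cfc (fun t : ℝ => (Real.sqrt t)⁻¹ * (Real.sqrt t)⁻¹) A = cfc (fun t : ℝ => (0 + t)⁻¹) A :=
    cfc_congr fun t ht => by
      rw [← mul_inv, Real.mul_self_sqrt (spectrum_pos_of_posDef hA t ht).le, zero_add]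
  rw [h1, ← resolvent_eq_cfc_of_posDef hA le_rfl, Complex.ofReal_zero, zero_smul, zero_add]

omit [DecidableEq n] in
/-- **An accretive Hermitian matrix is positive definite.** [folklore] -/
private theorem posDef_of_accretive {A : Matrix n n ℂ} (hA : A.IsHermitian) {m : ℝ} (hm : 0 < m)
    (hacc : ∀ v : n → ℂ, m * ∑ i, ‖v i‖ ^ 2 ≤ (∑ i, star (v i) * (A *ᵥ v) i).re) : A.PosDef := by
  refine Matrix.PosDef.of_dotProduct_mulVec_pos hA fun x hx => ?_
  have hform : star x ⬝ᵥ (A *ᵥ x) = ∑ i, star (x i) * (A *ᵥ x) i := rfl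
  have him : (star x ⬝ᵥ (A *ᵥ x)).im = 0 := by
    have h := hA.im_star_dotProduct_mulVec_self x
    rwa [RCLike.im_to_complex] at h
  obtain ⟨i₀, hi₀⟩ := Function.ne_iff.1 hx
  have hpos : 0 < ∑ i, ‖x i‖ ^ 2 := by
    refine lt_of_lt_of_le (by positivity : 0 < ‖x i₀‖ ^ 2) ?_
    exact Finset.single_le_sum (f := fun i => ‖x i‖ ^ 2) (fun i _ => by positivity) (Finset.mem_univ i₀)
  rw [Complex.lt_def]
  refine ⟨?_, ?_⟩
  · rw [Complex.zero_re, hform]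
    exact lt_of_lt_of_le (mul_pos hm hpos) (hacc x)
  · rw [Complex.zero_im, him]

/-! ### §3c. The general accretive case by analytic continuation -/

omit [DecidableEq n] in
/-- Linearity of the form in the matrix: `⟨v,(A + z·B)v⟩ = ⟨v,Av⟩ + z·⟨v,Bv⟩`. [folklore] -/
private theorem form_add_smul (A B : Matrix n n ℂ) (z : ℂ) (v : n → ℂ) :
    (∑ i, star (v i) * ((A + z • B) *ᵥ v) i)
      = (∑ i, star (v i) * (A *ᵥ v) i) + z * ∑ i, star (v i) * (B *ᵥ v) i := by
  simp only [Matrix.add_mulVec, Matrix.smul_mulVec, Pi.add_apply, Pi.smul_apply, smul_eq_mul, mul_add,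
    Finset.sum_add_distrib, Finset.mul_sum]
  congr 1
  exact Finset.sum_congr rfl fun i _ => by ring

omit [DecidableEq n] in
/-- The form of a Hermitian matrix is real. [folklore] -/
private theorem form_im_eq_zero {K : Matrix n n ℂ} (hK : K.IsHermitian) (v : n → ℂ) :
    (∑ i, star (v i) * (K *ᵥ v) i).im = 0 := by
  have h := hK.im_star_dotProduct_mulVec_self v
  rwa [RCLike.im_to_complex] at h

/-- An accretive matrix is invertible. [folklore] -/
private theorem isUnit_det_of_accretive (T : Matrix n n ℂ) {m : ℝ} (hm : 0 < m)
    (hacc : ∀ v : n → ℂ, m * ∑ i, ‖v i‖ ^ 2 ≤ (∑ i, star (v i) * (T *ᵥ v) i).re) : IsUnit T.det := by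
  have h := (resolvent_bound_of_accretive T hm hacc le_rfl).1
  rwa [Complex.ofReal_zero, zero_smul, zero_add] at h

/-- **`T^{−1/2}·T^{−1/2} = T⁻¹` FOR EVERY ACCRETIVE KERNEL — the resolvent-integral object (2.7) IS the square root
of the covariance `C^{(k)} = (C*Δ_kC)⁻¹` at complex background**, not only at the symmetric point.  Proof: write
`T = H + iK` with `H = (T + Tᴴ)/2`, `K = (T − Tᴴ)/(2i)` Hermitian; on the vertical strip `|Re z|·κ < m/2`
(`κ` = the total mass of `K`) the family `z ↦ H + zK` is uniformly `m/2`-accretive, so by §3a both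
`z ↦ (invSqrt·invSqrt)(H + zK)` and `z ↦ (H + zK)⁻¹` are entrywise holomorphic there; they agree for REAL `z` in the
strip (where `H + zK` is positive definite Hermitian, §3b), hence on the whole strip by the identity theorem, in
particular at `z = i`. [cite: Balaban1988RG2Cluster, (2.7) p.13, p.15] -/
theorem invSqrt_mul_invSqrt (T : Matrix n n ℂ) {m : ℝ} (hm : 0 < m)
    (hacc : ∀ v : n → ℂ, m * ∑ i, ‖v i‖ ^ 2 ≤ (∑ i, star (v i) * (T *ᵥ v) i).re) :
    invSqrt T * invSqrt T = T⁻¹ := by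
  -- the Cartesian decomposition `T = H + iK`
  set K : Matrix n n ℂ := (-Complex.I / 2) • (T - Tᴴ) with hKdef
  set H : Matrix n n ℂ := T - Complex.I • K with hHdef
  have hIK : Complex.I • K = (1 / 2 : ℂ) • (T - Tᴴ) := by
    rw [hKdef, smul_smul]
    congr 1
    rw [mul_div_assoc', mul_neg, Complex.I_mul_I]
    norm_num
  have hK : K.IsHermitian := by
    change Kᴴ = K
    rw [hKdef, Matrix.conjTranspose_smul, Matrix.conjTranspose_sub, Matrix.conjTranspose_conjTranspose]
    have hc : star (-Complex.I / 2) = -(-Complex.I / 2) := by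
      rw [Complex.star_def, map_div₀, map_neg, Complex.conj_I, map_ofNat]; ring
    rw [hc, neg_smul, ← smul_neg, neg_sub]
  have hH : H.IsHermitian := by
    change Hᴴ = H
    rw [hHdef, hIK, Matrix.conjTranspose_sub, Matrix.conjTranspose_smul, Matrix.conjTranspose_sub,
      Matrix.conjTranspose_conjTranspose]
    have hc : star (1 / 2 : ℂ) = 1 / 2 := by
      rw [Complex.star_def, map_div₀, map_one, map_ofNat]
    rw [hc]
    module
  -- the family `F z = T + (z − i)K = H + zK`
  set F : ℂ → Matrix n n ℂ := fun z => T + (z - Complex.I) • K with hFdef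
  have hFI : F Complex.I = T := by simp [hFdef]
  have hFreal : ∀ t : ℝ, F t = H + (t : ℂ) • K := fun t => by
    simp only [hFdef, hHdef]
    module
  -- the mass of `K`
  set κ : ℝ := ∑ i, ∑ j, ‖K i j‖ with hκdef
  have hκ0 : 0 ≤ κ := Finset.sum_nonneg fun i _ => Finset.sum_nonneg fun j _ => norm_nonneg _
  have hrowK : ∀ i, ∑ j, ‖K i j‖ ≤ κ := fun i =>
    Finset.single_le_sum (f := fun i => ∑ j, ‖K i j‖) (fun i _ => Finset.sum_nonneg fun j _ => norm_nonneg _)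
      (Finset.mem_univ i)
  have hcolK : ∀ j, ∑ i, ‖K i j‖ ≤ κ := fun j => by
    rw [hκdef, Finset.sum_comm]
    exact Finset.single_le_sum (f := fun j => ∑ i, ‖K i j‖) (fun j _ => Finset.sum_nonneg fun i _ => norm_nonneg _)
      (Finset.mem_univ j)
  -- the strip and accretivity on it
  set S : Set ℂ := {z : ℂ | |z.re| * κ < m / 2} with hSdef
  have hm2 : 0 < m / 2 := by linarith
  have haccF : ∀ z ∈ S, ∀ v : n → ℂ,
      m / 2 * ∑ i, ‖v i‖ ^ 2 ≤ (∑ i, star (v i) * (F z *ᵥ v) i).re := by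
    intro z hz v
    have hz' : |z.re| * κ < m / 2 := hz
    have hsplit := form_add_smul T K (z - Complex.I) v
    have him := form_im_eq_zero hK v
    have hbd := abs_re_form_le K hκ0 hrowK hcolK v
    have hre : (∑ i, star (v i) * (F z *ᵥ v) i).re
        = (∑ i, star (v i) * (T *ᵥ v) i).re + z.re * (∑ i, star (v i) * (K *ᵥ v) i).re := by
      change (∑ i, star (v i) * ((T + (z - Complex.I) • K) *ᵥ v) i).re = _
      rw [hsplit, Complex.add_re, Complex.mul_re, him, Complex.sub_re, Complex.I_re, sub_zero, mul_zero,
        sub_zero]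
    rw [hre]
    have hS0 : 0 ≤ ∑ i, ‖v i‖ ^ 2 := Finset.sum_nonneg fun i _ => by positivity
    have h1 := hacc v
    have h2 : |z.re * (∑ i, star (v i) * (K *ᵥ v) i).re| ≤ m / 2 * ∑ i, ‖v i‖ ^ 2 := by
      rw [abs_mul]
      calc |z.re| * |(∑ i, star (v i) * (K *ᵥ v) i).re| ≤ |z.re| * (κ * ∑ i, ‖v i‖ ^ 2) :=
            mul_le_mul_of_nonneg_left hbd (abs_nonneg _)
        _ = (|z.re| * κ) * ∑ i, ‖v i‖ ^ 2 := by ring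
        _ ≤ m / 2 * ∑ i, ‖v i‖ ^ 2 := mul_le_mul_of_nonneg_right hz'.le hS0
    have h3 := neg_le_of_abs_le h2
    linarith
  -- the strip is open, convex, contains `0` and `i`
  have hSopen : IsOpen S :=
    isOpen_lt ((continuous_abs.comp Complex.continuous_re).mul continuous_const) continuous_const
  have hSconv : Convex ℝ S := by
    have h1 : Convex ℝ {z : ℂ | z.re * κ < m / 2} :=
      convex_halfSpace_lt ⟨fun x y => by simp only [Complex.add_re, add_mul], fun c x => by
        simp only [Complex.real_smul, Complex.mul_re, Complex.ofReal_re, Complex.ofReal_im, zero_mul, sub_zero,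
          smul_eq_mul, mul_assoc]⟩ _
    have h2 : Convex ℝ {z : ℂ | -z.re * κ < m / 2} :=
      convex_halfSpace_lt ⟨fun x y => by simp only [Complex.add_re]; ring, fun c x => by
        simp only [Complex.real_smul, Complex.mul_re, Complex.ofReal_re, Complex.ofReal_im, zero_mul, sub_zero,
          smul_eq_mul]; ring⟩ _
    have hS' : S = {z : ℂ | z.re * κ < m / 2} ∩ {z : ℂ | -z.re * κ < m / 2} := by
      ext z
      simp only [hSdef, Set.mem_setOf_eq, Set.mem_inter_iff]
      rw [show |z.re| * κ = |z.re * κ| by rw [abs_mul, abs_of_nonneg hκ0], abs_lt, neg_mul]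
      constructor
      · rintro ⟨ha, hb⟩; exact ⟨hb, by linarith⟩
      · rintro ⟨ha, hb⟩; exact ⟨by linarith, ha⟩
    rw [hS']
    exact h1.inter h2
  have hSpre : IsPreconnected S := hSconv.isPreconnected
  have h0S : (0 : ℂ) ∈ S := by
    change |(0 : ℂ).re| * κ < m / 2
    rw [Complex.zero_re, abs_zero, zero_mul]; exact hm2
  have hIS : Complex.I ∈ S := by
    change |Complex.I.re| * κ < m / 2
    rw [Complex.I_re, abs_zero, zero_mul]; exact hm2
  -- holomorphy of the entries on the strip
  have hFdiff : ∀ i j, DifferentiableOn ℂ (fun z => F z i j) S := fun i j => by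
    simp only [hFdef, Matrix.add_apply, Matrix.smul_apply, smul_eq_mul]
    exact (differentiableOn_const _).add
      ((differentiableOn_id.sub (differentiableOn_const _)).mul (differentiableOn_const _))
  have hSq : ∀ i j, DifferentiableOn ℂ (fun z => invSqrt (F z) i j) S := fun i j =>
    differentiableOn_invSqrt_apply_of_isOpen F hSopen hm2 haccF hFdiff i j
  have hInv : ∀ i j, DifferentiableOn ℂ (fun z => (F z)⁻¹ i j) S := fun i j =>
    differentiableOn_inv_apply hFdiff (fun z hz => isUnit_det_of_accretive (F z) hm2 (haccF z hz)) i j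
  ext i j
  set f : ℂ → ℂ := fun z => (invSqrt (F z) * invSqrt (F z) - (F z)⁻¹) i j with hfdef
  have hfdiff : DifferentiableOn ℂ f S := by
    have hf' : f = fun z => (∑ k, invSqrt (F z) i k * invSqrt (F z) k j) - (F z)⁻¹ i j := by
      funext z
      simp only [hfdef, Matrix.sub_apply, Matrix.mul_apply]
    rw [hf']
    exact (DifferentiableOn.fun_sum fun k _ => (hSq i k).mul (hSq k j)).sub (hInv i j)
  have hfan : AnalyticOnNhd ℂ f S := hfdiff.analyticOnNhd hSopen
  -- `f` vanishes at the real points of the strip (positive definite Hermitian case)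
  have hfreal : ∀ t : ℝ, |t| * κ < m / 2 → f t = 0 := by
    intro t ht
    have htS : (t : ℂ) ∈ S := by
      change |(t : ℂ).re| * κ < m / 2
      rwa [Complex.ofReal_re]
    have hherm : (F t).IsHermitian := by
      rw [hFreal t]
      change (H + (t : ℂ) • K)ᴴ = H + (t : ℂ) • K
      rw [Matrix.conjTranspose_add, Matrix.conjTranspose_smul, hH.eq, hK.eq, Complex.star_def,
        Complex.conj_ofReal]
    have hpd : (F t).PosDef := posDef_of_accretive hherm hm2 (haccF _ htS)
    simp only [hfdef, invSqrt_mul_invSqrt_of_posDef hpd, sub_self, Matrix.zero_apply]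
  -- … hence frequently near `0` within the punctured strip
  have hfreq : ∃ᶠ z in 𝓝[≠] (0 : ℂ), f z = 0 := by
    have htend : Tendsto (fun k : ℕ => ((1 / ((k : ℝ) + 1) : ℝ) : ℂ)) atTop (𝓝[≠] (0 : ℂ)) := by
      refine tendsto_nhdsWithin_iff.2 ⟨?_, Filter.Eventually.of_forall fun k => ?_⟩
      · have h2 := (Complex.continuous_ofReal.tendsto 0).comp tendsto_one_div_add_atTop_nhds_zero_nat
        rwa [Complex.ofReal_zero] at h2
      · simp only [Set.mem_compl_iff, Set.mem_singleton_iff, Complex.ofReal_eq_zero, one_div, inv_eq_zero]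
        positivity
    refine htend.frequently (Filter.Eventually.frequently ?_)
    have hsmall : Tendsto (fun k : ℕ => |1 / ((k : ℝ) + 1)| * κ) atTop (𝓝 (|(0 : ℝ)| * κ)) :=
      ((continuous_abs.tendsto 0).comp tendsto_one_div_add_atTop_nhds_zero_nat).mul_const κ
    rw [abs_zero, zero_mul] at hsmall
    filter_upwards [hsmall.eventually (gt_mem_nhds hm2)] with k hk using hfreal _ hk
  have hzero := hfan.eqOn_zero_of_preconnected_of_frequently_eq_zero hSpre h0S hfreq hIS
  simp only [Pi.zero_apply, hfdef, hFI, Matrix.sub_apply] at hzero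
  exact sub_eq_zero.1 hzero

end Square


/-! ## §4. Accretivity from the §2-chain's standing structure: complex SYMMETRIC precision with positive definite real part -/

omit [DecidableEq n] in
/-- Real part of the form of a complexified real matrix (copy of `B13Sqrt27Accretive`'s private helper):
`Re Σ conj(v_i)(T₀v)_i = ⟨Re v, T₀ Re v⟩ + ⟨Im v, T₀ Im v⟩`. [folklore] -/
private theorem re_form_map_ofReal' (T₀ : Matrix n n ℝ) (v : n → ℂ) :
    (∑ i, star (v i) * ((T₀.map (algebraMap ℝ ℂ)) *ᵥ v) i).re
      = (fun i => (v i).re) ⬝ᵥ (T₀ *ᵥ fun i => (v i).re)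
        + (fun i => (v i).im) ⬝ᵥ (T₀ *ᵥ fun i => (v i).im) := by
  simp only [Matrix.mulVec, dotProduct, Matrix.map_apply, Complex.re_sum, Complex.mul_re,
    Complex.star_def, Complex.conj_re, Complex.conj_im, Finset.mul_sum, ← Finset.sum_add_distrib]
  refine Finset.sum_congr rfl fun i _ => Finset.sum_congr rfl fun j _ => ?_
  simp only [Complex.mul_im, Algebra.algebraMap_eq_smul_one, Complex.real_smul, mul_one,
    Complex.ofReal_re, Complex.ofReal_im, zero_mul, sub_zero, add_zero]
  ring

omit [DecidableEq n] in
/-- **The form of `i·S` for a real SYMMETRIC `S` has vanishing real part**: `Re Σ conj(v_i)((iS)v)_i = 0` (the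
imaginary part of a real symmetric form is antisymmetric in the two real components of `v`). [folklore] -/
private theorem re_form_I_smul_symm (S : Matrix n n ℝ) (hS : S.IsSymm) (v : n → ℂ) :
    (∑ i, star (v i) * ((Complex.I • S.map (algebraMap ℝ ℂ)) *ᵥ v) i).re = 0 := by
  have hsym : ∀ i j, S i j = S j i := fun i j => by
    have h := congrFun (congrFun hS i) j
    simpa [Matrix.transpose_apply] using h.symm
  -- expand to a double sum of real numbers
  have hexp : (∑ i, star (v i) * ((Complex.I • S.map (algebraMap ℝ ℂ)) *ᵥ v) i).re
      = ∑ i, ∑ j, S i j * ((v i).im * (v j).re - (v i).re * (v j).im) := by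
    simp only [Matrix.mulVec, dotProduct, Matrix.smul_apply, Matrix.map_apply, Complex.re_sum, Finset.mul_sum,
      smul_eq_mul]
    refine Finset.sum_congr rfl fun i _ => Finset.sum_congr rfl fun j _ => ?_
    simp only [Complex.mul_re, Complex.mul_im, Complex.star_def, Complex.conj_re, Complex.conj_im, Complex.I_re,
      Complex.I_im, Algebra.algebraMap_eq_smul_one, Complex.real_smul, mul_one, Complex.ofReal_re,
      Complex.ofReal_im, zero_mul, one_mul, sub_zero, zero_sub, zero_add, mul_zero]
    ring
  rw [hexp]
  -- the double sum is antisymmetric under `i ↔ j`, hence zero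
  have hanti : ∑ i, ∑ j, S i j * ((v i).im * (v j).re - (v i).re * (v j).im)
      = -∑ i, ∑ j, S i j * ((v i).im * (v j).re - (v i).re * (v j).im) := by
    conv_rhs => rw [Finset.sum_comm]
    rw [← Finset.sum_neg_distrib]
    refine Finset.sum_congr rfl fun i _ => ?_
    rw [← Finset.sum_neg_distrib]
    refine Finset.sum_congr rfl fun j _ => ?_
    rw [hsym j i]
    ring
  linarith

omit [Fintype n] [DecidableEq n] in
/-- Entrywise Cartesian decomposition `A = (Re A) + i·(Im A)` as complexified real matrices. [folklore] -/
private theorem eq_re_add_I_im (A : Matrix n n ℂ) :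
    A = (A.map Complex.re).map (algebraMap ℝ ℂ) + Complex.I • (A.map Complex.im).map (algebraMap ℝ ℂ) := by
  ext i j
  apply Complex.ext <;> simp [Matrix.map_apply, Matrix.add_apply, Matrix.smul_apply]

omit [DecidableEq n] in
/-- **ACCRETIVITY FROM THE STANDING STRUCTURE OF THE (2.14)-CHAIN**: the tree's Lemma-3 capstones
(`B13Lemma3TorusPrimitive.h226_torus_of_primitives`, binders `hAs`, `hA`) carry the complex precision `A(σ)` as
COMPLEX SYMMETRIC with positive definite REAL PART; for such a kernel `Re Σ conj(v_i)(Av)_i = ⟨Re v, (Re A) Re v⟩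
+ ⟨Im v, (Re A) Im v⟩` (the symmetric imaginary part contributes nothing), so a `γ`-coercive real part makes `A`
`γ`-ACCRETIVE — the hypothesis `hacc` of `B13Sqrt27Accretive` ∕ §§1–3 above, supplied by name from the chain's
letters. [cite: Balaban1988RG2Cluster, p.15, (2.16) p.16] -/
theorem accretive_of_isSymm_re_coercive {A : Matrix n n ℂ} (hAs : A.IsSymm) {γ : ℝ}
    (hc : QGQInverse.Coercive (A.map Complex.re) γ) (v : n → ℂ) :
    γ * ∑ i, ‖v i‖ ^ 2 ≤ (∑ i, star (v i) * (A *ᵥ v) i).re := by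
  have hIm : (A.map Complex.im).IsSymm := by
    ext i j
    have h := congrFun (congrFun hAs i) j
    simp only [Matrix.transpose_apply] at h
    simp [Matrix.transpose_apply, Matrix.map_apply, h]
  have hsplit : (∑ i, star (v i) * (A *ᵥ v) i)
      = (∑ i, star (v i) * (((A.map Complex.re).map (algebraMap ℝ ℂ)) *ᵥ v) i)
        + ∑ i, star (v i) * ((Complex.I • (A.map Complex.im).map (algebraMap ℝ ℂ)) *ᵥ v) i := by
    conv_lhs => rw [eq_re_add_I_im A]
    simp only [Matrix.add_mulVec, Pi.add_apply, mul_add, Finset.sum_add_distrib]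
  rw [hsplit, Complex.add_re, re_form_I_smul_symm _ hIm, add_zero, re_form_map_ofReal']
  have h0 := hc (fun i => (v i).re)
  have h1 := hc (fun i => (v i).im)
  have h3 : ∑ i, ‖v i‖ ^ 2
      = (fun i => (v i).re) ⬝ᵥ (fun i => (v i).re) + (fun i => (v i).im) ⬝ᵥ (fun i => (v i).im) := by
    simp only [dotProduct, ← Finset.sum_add_distrib]
    refine Finset.sum_congr rfl fun i _ => ?_
    rw [Complex.sq_norm, Complex.normSq_apply]
  rw [h3, mul_add]
  exact add_le_add h0 h1

/-! ## §5 (v1.1, APPEND-ONLY; §§1–4 above byte-identical to v1 p425410). The algebra the complexified change of variables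
`B′ = (C^{(k)})^{1/2}X` of (2.6) uses at complex background: the square root is SYMMETRIC for a symmetric precision,
commutes with it, is invertible with `(T^{−1/2})⁻¹(T^{−1/2})⁻¹ = T`, and `det(T^{−1/2})² = (det T)⁻¹` -/

/-- **Transposition commutes with the square root**: `(T^{−1/2})ᵀ = (Tᵀ)^{−1/2}` (entry by entry, the resolvent of
the transpose is the transpose of the resolvent). [cite: Balaban1988RG2Cluster, (2.6)–(2.7) pp.12–13] -/
theorem invSqrt_transpose (T : Matrix n n ℂ) : (invSqrt T)ᵀ = invSqrt Tᵀ := by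
  ext i j
  rw [Matrix.transpose_apply, invSqrt_apply, invSqrt_apply]
  congr 1
  refine setIntegral_congr_fun measurableSet_Ioi fun x _ => ?_
  have h : ((x : ℂ) • (1 : Matrix n n ℂ) + Tᵀ) = ((x : ℂ) • (1 : Matrix n n ℂ) + T)ᵀ := by
    rw [Matrix.transpose_add, Matrix.transpose_smul, Matrix.transpose_one]
  simp only [h, ← Matrix.transpose_nonsing_inv, Matrix.transpose_apply]

/-- **The square root of a complex SYMMETRIC precision is symmetric** (print p. 15: the operators of (2.14) are complex
symmetric at complex background — the chain's binder `hAs`); so `⟨SX, A SX⟩ = ⟨X, SAS X⟩` in (2.6)/(2.23).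
[cite: Balaban1988RG2Cluster, (2.6) p.12, p.15] -/
theorem isSymm_invSqrt {T : Matrix n n ℂ} (hT : T.IsSymm) : (invSqrt T).IsSymm := by
  change (invSqrt T)ᵀ = invSqrt T
  rw [invSqrt_transpose, hT.eq]

/-- The resolvent commutes with `T`. [folklore] -/
private theorem resolvent_mul_comm (T : Matrix n n ℂ) {x : ℝ} (hu : IsUnit ((x : ℂ) • (1 : Matrix n n ℂ) + T).det) :
    ((x : ℂ) • (1 : Matrix n n ℂ) + T)⁻¹ * T = T * ((x : ℂ) • (1 : Matrix n n ℂ) + T)⁻¹ := by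
  set A : Matrix n n ℂ := (x : ℂ) • (1 : Matrix n n ℂ) + T with hA
  have hT : T = A - (x : ℂ) • (1 : Matrix n n ℂ) := by rw [hA]; abel
  rw [hT, Matrix.mul_sub, Matrix.sub_mul, Matrix.nonsing_inv_mul A hu, Matrix.mul_nonsing_inv A hu,
    Matrix.mul_smul, Matrix.smul_mul, Matrix.mul_one, Matrix.one_mul]

/-- **The square root commutes with the precision**: `T^{−1/2}·T = T·T^{−1/2}` (accretive `T`).
[cite: Balaban1988RG2Cluster, (2.6)–(2.7) pp.12–13] -/
theorem invSqrt_mul_comm (T : Matrix n n ℂ) {m : ℝ} (hm : 0 < m)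
    (hacc : ∀ v : n → ℂ, m * ∑ i, ‖v i‖ ^ 2 ≤ (∑ i, star (v i) * (T *ᵥ v) i).re) :
    invSqrt T * T = T * invSqrt T := by
  have hI := fun i j => integrableOn_integrand T hm hacc i j
  ext i j
  simp only [Matrix.mul_apply, invSqrt_apply]
  -- move the constants inside the integrals and the finite sums inside
  have hL : ∀ k, ((π⁻¹ : ℝ) • ∫ x in Ioi (0 : ℝ), (Real.sqrt x)⁻¹ • ((x : ℂ) • (1 : Matrix n n ℂ) + T)⁻¹ i k) * T k j
      = (π⁻¹ : ℝ) • ∫ x in Ioi (0 : ℝ), (Real.sqrt x)⁻¹ • (((x : ℂ) • (1 : Matrix n n ℂ) + T)⁻¹ i k * T k j) := by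
    intro k
    rw [Complex.real_smul, Complex.real_smul, mul_assoc, ← integral_mul_const]
    congr 1
    refine setIntegral_congr_fun measurableSet_Ioi fun x _ => ?_
    rw [Complex.real_smul, Complex.real_smul, mul_assoc]
  have hR : ∀ k, T i k * ((π⁻¹ : ℝ) • ∫ x in Ioi (0 : ℝ), (Real.sqrt x)⁻¹ • ((x : ℂ) • (1 : Matrix n n ℂ) + T)⁻¹ k j)
      = (π⁻¹ : ℝ) • ∫ x in Ioi (0 : ℝ), (Real.sqrt x)⁻¹ • (T i k * ((x : ℂ) • (1 : Matrix n n ℂ) + T)⁻¹ k j) := by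
    intro k
    rw [Complex.real_smul, Complex.real_smul, mul_left_comm, ← integral_const_mul]
    congr 1
    refine setIntegral_congr_fun measurableSet_Ioi fun x _ => ?_
    rw [Complex.real_smul, Complex.real_smul, mul_left_comm]
  simp only [hL, hR, ← Finset.smul_sum]
  congr 1
  have hIL : ∀ k, IntegrableOn (fun x : ℝ => (Real.sqrt x)⁻¹ • (((x : ℂ) • (1 : Matrix n n ℂ) + T)⁻¹ i k * T k j))
      (Ioi 0) := fun k => by
    have h : IntegrableOn (fun x : ℝ => (Real.sqrt x)⁻¹ • ((x : ℂ) • (1 : Matrix n n ℂ) + T)⁻¹ i k * T k j)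
        (Ioi 0) := (hI i k).mul_const (T k j)
    refine h.congr_fun (fun x _ => ?_) measurableSet_Ioi
    simp only [Complex.real_smul, mul_assoc]
  have hIR : ∀ k, IntegrableOn (fun x : ℝ => (Real.sqrt x)⁻¹ • (T i k * ((x : ℂ) • (1 : Matrix n n ℂ) + T)⁻¹ k j))
      (Ioi 0) := fun k => by
    have h : IntegrableOn (fun x : ℝ => T i k * (Real.sqrt x)⁻¹ • ((x : ℂ) • (1 : Matrix n n ℂ) + T)⁻¹ k j)
        (Ioi 0) := (hI k j).const_mul (T i k)
    refine h.congr_fun (fun x _ => ?_) measurableSet_Ioi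
    simp only [Complex.real_smul, mul_left_comm]
  rw [← integral_finsetSum _ (fun k _ => hIL k), ← integral_finsetSum _ (fun k _ => hIR k)]
  refine setIntegral_congr_fun measurableSet_Ioi fun x hx => ?_
  have hx0 : (0 : ℝ) < x := hx
  simp only [← Finset.smul_sum]
  congr 1
  have h := resolvent_mul_comm T (resolvent_bound_of_accretive T hm hacc hx0.le).1
  have h' := congrFun (congrFun h i) j
  simpa only [Matrix.mul_apply] using h'

/-- **The square root is invertible and `(T^{−1/2})⁻¹·(T^{−1/2})⁻¹ = T`** — i.e. `(C^{(k)})^{1/2}·(C^{(k)})^{1/2} = C^{(k)}`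
read with `C^{(k)} = T⁻¹` inverted (accretive `T`). [cite: Balaban1988RG2Cluster, (2.6)–(2.7) pp.12–13] -/
theorem isUnit_invSqrt_det (T : Matrix n n ℂ) {m : ℝ} (hm : 0 < m)
    (hacc : ∀ v : n → ℂ, m * ∑ i, ‖v i‖ ^ 2 ≤ (∑ i, star (v i) * (T *ᵥ v) i).re) :
    IsUnit (invSqrt T).det := by
  have hT : IsUnit T.det := by
    have h := (resolvent_bound_of_accretive T hm hacc le_rfl).1
    rwa [Complex.ofReal_zero, zero_smul, zero_add] at h
  have hsq := invSqrt_mul_invSqrt T hm hacc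
  have h1 : invSqrt T * (invSqrt T * T) = 1 := by
    rw [← Matrix.mul_assoc, hsq, Matrix.nonsing_inv_mul T hT]
  exact Matrix.isUnit_det_of_right_inverse h1

/-- `(T^{−1/2})⁻¹·(T^{−1/2})⁻¹ = T` for accretive `T`. [cite: Balaban1988RG2Cluster, (2.6)–(2.7) pp.12–13] -/
theorem inv_invSqrt_mul_inv_invSqrt (T : Matrix n n ℂ) {m : ℝ} (hm : 0 < m)
    (hacc : ∀ v : n → ℂ, m * ∑ i, ‖v i‖ ^ 2 ≤ (∑ i, star (v i) * (T *ᵥ v) i).re) :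
    (invSqrt T)⁻¹ * (invSqrt T)⁻¹ = T := by
  have hT : IsUnit T.det := by
    have h := (resolvent_bound_of_accretive T hm hacc le_rfl).1
    rwa [Complex.ofReal_zero, zero_smul, zero_add] at h
  rw [← Matrix.mul_inv_rev, invSqrt_mul_invSqrt T hm hacc, Matrix.nonsing_inv_nonsing_inv T hT]

/-- **`det(T^{−1/2})² = (det T)⁻¹`** — the determinant bookkeeping of the change of variables (2.6) ∕ (2.24) at complex
background (accretive `T`). [cite: Balaban1988RG2Cluster, (2.6) p.12, (2.24) p.17] -/
theorem det_invSqrt_sq (T : Matrix n n ℂ) {m : ℝ} (hm : 0 < m)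
    (hacc : ∀ v : n → ℂ, m * ∑ i, ‖v i‖ ^ 2 ≤ (∑ i, star (v i) * (T *ᵥ v) i).re) :
    (invSqrt T).det ^ 2 = (T.det)⁻¹ := by
  rw [sq, ← Matrix.det_mul, invSqrt_mul_invSqrt T hm hacc, Matrix.det_nonsing_inv, Ring.inverse_eq_inv']

end Literature.MathematicalPhysics.QuantumFieldTheory.Balaban1983to89.B13Sqrt27AccretiveSquare

end
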